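import Mathlib
import HarnessLib

/-!
# Crux `DivisionGap.ZeroOneTransfer` (stmt-ValiantsHypothesis-5066), line `charged-uncharged` —
stub `stub_sqrtCheap`, support file 1: the algebra of square roots at a unit base point

Registered stub `stub_sqrtCheap` of the line's skeleton says that the fan-in-two circuit complexity
is polynomially closed under square roots at a unit base point: over `ℂ`, if `f(0) = 1` then
`L(f) ≤ (L(f²) + deg f + #vars + 2)¹²` (Bürgisser 2000, §2, closure properties of `VP`; a baby case
of Kaltofen's factor theorem).  This file holds the circuit-free algebra of the proof; the
complexity bookkeeping is in the next file (`…StubSqrtCheap.lean`).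

* `homogeneousComponent_mul_eq_sum` — the Cauchy product formula for homogeneous components, and
  its consequences `homogeneousComponent_mul_eq_zero_of_lt`,
  `homogeneousComponent_pow_eq_zero_of_constantCoeff`, `homogeneousComponent_pow_mul_eq_zero`:
  a polynomial `u` with zero constant term has `(uᵐ · R)_i = 0` for `i < m`.
* `homogeneousComponent_eq_of_sq` — UNIQUENESS of square roots with constant term `1` modulo high
  degree: if `A₀ = B₀ = 1` and `(A²)_i = (B²)_i` for `i ≤ d` then `A_i = B_i` for `i ≤ d`
  (strong induction on `i`: `(A²)_i = 2 A_i + Σ_{0<a<i} A_a A_{i-a}`, and `2` is invertible).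
* `exists_sqrt_series` — EXISTENCE of the truncated square-root series: a polynomial `T ∈ ℂ[Y]` of
  degree `≤ d` with `T(0) = 1` and `Y^{d+1} ∣ T² - (1 + Y)` (the truncation of Mathlib's binomial
  series `PowerSeries.binomialSeries ℂ (1/2)`, squared by `binomialSeries_add`).
* `aeval_scale_eq_sum` — the scaling substitution `x ↦ t·x` acts on the degree-`e` component by
  `tᵉ`: `Q(t·x) = Σ_{e ≤ m} tᵉ Q_e` for `deg Q ≤ m`.
* `exists_dualWeights`, `homogeneousComponent_eq_sum_scale` — INTERPOLATION: with the Lagrange dual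
  weights `w_r` of the nodes `0, 1, …, m` (`Σ_r w_r rᵉ = [e = i]` for `e ≤ m`, from Mathlib's
  `Lagrange.eq_interpolate`), `Q_i = Σ_{r ≤ m} w_r · Q(r·x)` for `i ≤ m`.

Everything is elementary; no circuits, no new definitions.  Registered sub-goal proved here:
`stub_sqrtCheap_sqrtSeries` (= `SqrtCheap.exists_sqrt_series`). [folklore]
-/

set_option linter.dupNamespace false

namespace Summit.ValiantsHypothesis.ValiantsHypothesis.Theorems.DivisionGapZeroOneTransfer

namespace SqrtCheap

open MvPolynomial

section CauchyProduct

variable {R : Type*} [CommRing R] {σ : Type*}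

/-- **Cauchy product for homogeneous components**: `(φ ψ)_n = Σ_{i ≤ n} φ_i ψ_{n-i}`
(the tree's `DepthReduction.homogeneousComponent_mul`, restated here to keep the imports of this
support file inside Mathlib). [folklore] -/
theorem homogeneousComponent_mul_eq_sum (n : ℕ) (φ ψ : MvPolynomial σ R) :
    homogeneousComponent n (φ * ψ) =
      ∑ i ∈ Finset.range (n + 1), homogeneousComponent i φ * homogeneousComponent (n - i) ψ := by
  -- adapted from Literature/Computability/AlgebraicComplexity/GateQuotients.lean
  classical
  ext m
  rw [coeff_homogeneousComponent, coeff_sum]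
  simp_rw [coeff_mul, coeff_homogeneousComponent]
  rw [Finset.sum_comm]
  split_ifs with hm
  · apply Finset.sum_congr rfl
    rintro ⟨p, q⟩ hpq
    rw [Finset.HasAntidiagonal.mem_antidiagonal] at hpq
    have hdeg : p.degree + q.degree = n := by rw [← map_add, hpq, hm]
    rw [Finset.sum_eq_single p.degree]
    · simp [show n - p.degree = q.degree by omega]
    · intro i _ hne
      simp [Ne.symm hne]
    · intro h
      simp at h
      omega
  · symm
    apply Finset.sum_eq_zero
    rintro ⟨p, q⟩ hpq
    apply Finset.sum_eq_zero
    intro i hi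
    rw [Finset.HasAntidiagonal.mem_antidiagonal] at hpq
    rw [Finset.mem_range] at hi
    split_ifs with h1 h2
    · exfalso
      apply hm
      rw [← hpq, map_add, h1, h2]
      omega
    all_goals simp

/-- If the components of `A` below degree `a` and those of `B` below degree `b` vanish, then the
components of `A B` below degree `a + b` vanish. [folklore] -/
theorem homogeneousComponent_mul_eq_zero_of_lt {a b : ℕ} {A B : MvPolynomial σ R}
    (hA : ∀ i < a, homogeneousComponent i A = 0) (hB : ∀ j < b, homogeneousComponent j B = 0) :
    ∀ n < a + b, homogeneousComponent n (A * B) = 0 := by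
  intro n hn
  rw [homogeneousComponent_mul_eq_sum]
  refine Finset.sum_eq_zero fun i hi => ?_
  rw [Finset.mem_range] at hi
  by_cases hia : i < a
  · rw [hA i hia, zero_mul]
  · rw [hB (n - i) (by omega), mul_zero]

/-- A polynomial `u` with zero constant term has `(uᵐ)_i = 0` for all `i < m` (every monomial of
`uᵐ` has degree `≥ m`). [folklore] -/
theorem homogeneousComponent_pow_eq_zero_of_constantCoeff {u : MvPolynomial σ R}
    (hu : constantCoeff u = 0) : ∀ (m : ℕ), ∀ i < m, homogeneousComponent i (u ^ m) = 0 := by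
  intro m
  induction m with
  | zero => intro i hi; omega
  | succ m ih =>
    rw [pow_succ]
    refine homogeneousComponent_mul_eq_zero_of_lt ih ?_
    intro j hj
    have hj0 : j = 0 := by omega
    subst hj0
    rw [homogeneousComponent_zero, ← constantCoeff_eq, hu, C_0]

/-- A multiple `uᵐ · R` of the `m`-th power of a polynomial `u` with zero constant term has no
homogeneous components below degree `m`. [folklore] -/
theorem homogeneousComponent_pow_mul_eq_zero {u : MvPolynomial σ R} (hu : constantCoeff u = 0)
    (m : ℕ) (Rr : MvPolynomial σ R) : ∀ i < m, homogeneousComponent i (u ^ m * Rr) = 0 := by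
  intro i hi
  exact homogeneousComponent_mul_eq_zero_of_lt
    (homogeneousComponent_pow_eq_zero_of_constantCoeff hu m) (b := 0) (fun j hj => by omega) i
    (by omega)

end CauchyProduct

section SquareRoots

variable {σ : Type*}

/-- **Uniqueness of square roots with constant term `1`, modulo high degree.**  If `A₀ = B₀ = 1`
and `(A²)_i = (B²)_i` for all `i ≤ d`, then `A_i = B_i` for all `i ≤ d`: by strong induction,
`(A²)_i = 2 A_i + Σ_{0<a<i} A_a A_{i-a}` (Cauchy product with `A₀ = 1`), the middle sums agree by
induction, and `2 ≠ 0` in `ℂ`. [folklore] -/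
theorem homogeneousComponent_eq_of_sq {A B : MvPolynomial σ ℂ} (d : ℕ)
    (hA0 : homogeneousComponent 0 A = 1) (hB0 : homogeneousComponent 0 B = 1)
    (hsq : ∀ i ≤ d, homogeneousComponent i (A * A) = homogeneousComponent i (B * B)) :
    ∀ i ≤ d, homogeneousComponent i A = homogeneousComponent i B := by
  intro i
  induction i using Nat.strong_induction_on with
  | _ i ih =>
  intro hi
  rcases i with _ | j
  · rw [hA0, hB0]
  · have key : ∀ Q : MvPolynomial σ ℂ, homogeneousComponent 0 Q = 1 →
        homogeneousComponent (j + 1) (Q * Q) = (2 : ℂ) • homogeneousComponent (j + 1) Q +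
          ∑ a ∈ Finset.range j,
            homogeneousComponent (a + 1) Q * homogeneousComponent (j - a) Q := by
      intro Q hQ0
      rw [homogeneousComponent_mul_eq_sum, Finset.sum_range_succ', Finset.sum_range_succ, hQ0]
      simp only [Nat.sub_self, Nat.sub_zero, hQ0, mul_one, one_mul, Nat.add_sub_add_right,
        two_smul]
      abel
    have hmid : ∑ a ∈ Finset.range j,
        homogeneousComponent (a + 1) A * homogeneousComponent (j - a) A =
        ∑ a ∈ Finset.range j,
          homogeneousComponent (a + 1) B * homogeneousComponent (j - a) B := by
      refine Finset.sum_congr rfl fun a ha => ?_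
      rw [Finset.mem_range] at ha
      rw [ih (a + 1) (by omega) (by omega), ih (j - a) (by omega) (by omega)]
    have h2 : (2 : ℂ) • homogeneousComponent (j + 1) A =
        (2 : ℂ) • homogeneousComponent (j + 1) B := by
      have := hsq (j + 1) hi
      rw [key A hA0, key B hB0, hmid] at this
      exact add_right_cancel this
    exact smul_right_injective _ (two_ne_zero' ℂ) h2

/-- **The truncated square-root series.**  For every `d` there is `T ∈ ℂ[Y]` of degree `≤ d` with
`T(0) = 1` and `Y^{d+1} ∣ T² - (1 + Y)`: the degree-`d` truncation of the binomial series
`(1 + Y)^{1/2}` (Mathlib's `PowerSeries.binomialSeries`, with `binomialSeries_add` giving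
`(1+Y)^{1/2} · (1+Y)^{1/2} = (1+Y)^1`). [folklore] -/
theorem exists_sqrt_series (d : ℕ) : ∃ T : Polynomial ℂ, T.natDegree < d + 1 ∧ T.coeff 0 = 1 ∧
    Polynomial.X ^ (d + 1) ∣ T ^ 2 - (1 + Polynomial.X) := by
  set B : PowerSeries ℂ := PowerSeries.binomialSeries ℂ (1 / 2 : ℂ) with hB
  have hBB : B ^ 2 = 1 + PowerSeries.X := by
    rw [sq, hB, ← PowerSeries.binomialSeries_add, add_halves,
      show (1 : ℂ) = ((1 : ℕ) : ℂ) by simp, PowerSeries.binomialSeries_nat, pow_one]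
  refine ⟨PowerSeries.trunc (d + 1) B, PowerSeries.natDegree_trunc_lt _ _, ?_, ?_⟩
  · rw [PowerSeries.coeff_trunc, if_pos (Nat.succ_pos d), hB, PowerSeries.binomialSeries_coeff]
    simp
  · rw [Polynomial.X_pow_dvd_iff]
    intro n hn
    rw [Polynomial.coeff_sub, sub_eq_zero, ← Polynomial.coeff_coe, Polynomial.coe_pow,
      ← PowerSeries.coeff_coe_trunc_of_lt hn, PowerSeries.trunc_trunc_pow,
      PowerSeries.coeff_coe_trunc_of_lt hn, hBB, ← Polynomial.coeff_coe]
    simp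

end SquareRoots

section Interpolation

variable {τ : Type*}

/-- The scaling substitution `x ↦ t · x` multiplies a monomial of degree `e` by `tᵉ`. [folklore] -/
theorem aeval_scale_monomial (t : ℂ) (s : τ →₀ ℕ) (a : ℂ) :
    aeval (fun x => C t * X x) (monomial s a) = t ^ s.degree • monomial s a := by
  classical
  rw [aeval_monomial, algebraMap_eq]
  simp_rw [mul_pow]
  rw [Finsupp.prod_mul]
  simp only [Finsupp.prod]
  rw [Finset.prod_pow_eq_pow_sum, prod_X_pow_eq_monomial, ← Finsupp.degree_apply, ← C_pow,
    C_mul_monomial, C_mul_monomial, smul_monomial, smul_eq_mul]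
  congr 1
  ring

/-- The scaling substitution `x ↦ t · x` multiplies a homogeneous polynomial of degree `e` by
`tᵉ`. [folklore] -/
theorem aeval_scale_of_isHomogeneous (t : ℂ) {H : MvPolynomial τ ℂ} {e : ℕ}
    (hH : H.IsHomogeneous e) : aeval (fun x => C t * X x) H = t ^ e • H := by
  classical
  conv_lhs => rw [H.as_sum, map_sum]
  conv_rhs => rw [H.as_sum, Finset.smul_sum]
  refine Finset.sum_congr rfl fun s hs => ?_
  rw [aeval_scale_monomial]
  have hdeg : s.degree = e := by
    by_contra hne
    exact (mem_support_iff.mp hs) (hH.coeff_eq_zero hne)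
  rw [hdeg]

/-- A polynomial of total degree `≤ m` is the sum of its homogeneous components of degrees
`0, …, m` (Mathlib's `sum_homogeneousComponent`, padded with zero components). [folklore] -/
theorem sum_homogeneousComponent_of_le (Q : MvPolynomial τ ℂ) {m : ℕ} (hm : Q.totalDegree ≤ m) :
    ∑ i ∈ Finset.range (m + 1), homogeneousComponent i Q = Q := by
  induction m, hm using Nat.le_induction with
  | base => exact sum_homogeneousComponent Q
  | succ m hm ih =>
    rw [Finset.sum_range_succ, ih, homogeneousComponent_eq_zero _ _ (by omega), add_zero]

/-- **Scaling separates degrees**: `Q(t · x) = Σ_{e ≤ m} tᵉ · Q_e(x)` for `deg Q ≤ m`. [folklore] -/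
theorem aeval_scale_eq_sum (t : ℂ) (Q : MvPolynomial τ ℂ) {m : ℕ} (hm : Q.totalDegree ≤ m) :
    aeval (fun x => C t * X x) Q =
      ∑ e ∈ Finset.range (m + 1), t ^ e • homogeneousComponent e Q := by
  conv_lhs => rw [← sum_homogeneousComponent_of_le Q hm, map_sum]
  exact Finset.sum_congr rfl fun e _ =>
    aeval_scale_of_isHomogeneous t (homogeneousComponent_isHomogeneous e Q)

/-- **Dual (inverse Vandermonde) weights at the nodes `0, 1, …, m`**: there are `w_r ∈ ℂ` with
`Σ_{r ≤ m} w_r · rᵉ = [e = i]` for all `e ≤ m` — the coefficient of `Yⁱ` in the Lagrange basis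
polynomials (Mathlib's `Lagrange.eq_interpolate` applied to `Yᵉ`). [folklore] -/
theorem exists_dualWeights (m i : ℕ) : ∃ w : ℕ → ℂ, ∀ e ≤ m,
    ∑ r ∈ Finset.range (m + 1), w r * (r : ℂ) ^ e = if e = i then 1 else 0 := by
  -- adapted from Literature/Computability/AlgebraicComplexity/DepthThreeChasmProofs.lean
  -- (`sum_dualWeight_mul_pow`, there over `ℚ`)
  classical
  refine ⟨fun r => (Lagrange.basis (Finset.range (m + 1)) (Nat.cast : ℕ → ℂ) r).coeff i, ?_⟩
  intro e he
  have hinj : Set.InjOn (Nat.cast : ℕ → ℂ) (Finset.range (m + 1) : Set ℕ) :=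
    fun a _ b _ h => by exact_mod_cast h
  have hdeg : (Polynomial.X ^ e : Polynomial ℂ).degree < (Finset.range (m + 1)).card := by
    rw [Polynomial.degree_X_pow, Finset.card_range]
    exact_mod_cast Nat.lt_succ_of_le he
  have h := Lagrange.eq_interpolate hinj hdeg
  have hc := congrArg (fun p : Polynomial ℂ => p.coeff i) h
  simp only [Lagrange.interpolate_apply, Polynomial.eval_pow, Polynomial.eval_X,
    Polynomial.finsetSum_coeff, Polynomial.coeff_C_mul, Polynomial.coeff_X_pow] at hc
  rw [eq_comm] at hc
  simpa [mul_comm, eq_comm] using hc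

/-- **Homogeneous components by interpolation**: for `deg Q ≤ m`, `i ≤ m` and dual weights `w`
of the nodes `0, …, m`, `Q_i(x) = Σ_{r ≤ m} w_r · Q(r · x)`. [folklore] -/
theorem homogeneousComponent_eq_sum_scale (Q : MvPolynomial τ ℂ) {m i : ℕ}
    (hm : Q.totalDegree ≤ m) (hi : i ≤ m) {w : ℕ → ℂ}
    (hw : ∀ e ≤ m, ∑ r ∈ Finset.range (m + 1), w r * (r : ℂ) ^ e = if e = i then 1 else 0) :
    homogeneousComponent i Q =
      ∑ r ∈ Finset.range (m + 1), w r • aeval (fun x => C (r : ℂ) * X x) Q := by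
  simp_rw [aeval_scale_eq_sum _ Q hm, Finset.smul_sum, smul_smul]
  rw [Finset.sum_comm]
  simp_rw [← Finset.sum_smul]
  have key : ∀ e ∈ Finset.range (m + 1),
      (∑ r ∈ Finset.range (m + 1), w r * (r : ℂ) ^ e) • homogeneousComponent e Q =
        if e = i then homogeneousComponent e Q else 0 := by
    intro e he
    rw [hw e (by have := Finset.mem_range.mp he; omega)]
    split_ifs <;> simp
  rw [Finset.sum_congr rfl key, Finset.sum_ite_eq', if_pos (Finset.mem_range.mpr (by omega))]

end Interpolation

end SqrtCheap

/-- **Registered sub-goal `stub_sqrtCheap_sqrtSeries`** of `stub_sqrtCheap` (crux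
stmt-ValiantsHypothesis-5066, line `charged-uncharged`): the truncated square-root series exists —
for every `d` a polynomial `T ∈ ℂ[Y]` of degree `≤ d` with `T(0) = 1` and `Y^{d+1} ∣ T² - (1 + Y)`
(`SqrtCheap.exists_sqrt_series`). [folklore] -/
theorem stub_sqrtCheap_sqrtSeries : ∀ d : ℕ, ∃ T : Polynomial ℂ, T.natDegree < d + 1 ∧ T.coeff 0 = 1 ∧ Polynomial.X ^ (d + 1) ∣ T ^ 2 - (1 + Polynomial.X) :=
  SqrtCheap.exists_sqrt_series

end Summit.ValiantsHypothesis.ValiantsHypothesis.Theorems.DivisionGapZeroOneTransfer
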